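import Literature.NumberTheory.EllipticCurves.KellerYin2024.AnomalousImprimitiveLambdaInvariants
import Summits.BirchSwinnertonDyer.BirchSwinnertonDyer.Theorems.EisensteinPrimesUnrSelmerQuotientCorankLocalLambda
import Literature.NumberTheory.EllipticCurves.ModularityVersionApProofs
import HarnessLib

/-!
# Route `EisensteinPrimes` (rung K5), crux 2 `GoodLatticeBDPValue`, line `halves`: the BARE CORANK identity
# [PWL-θ] from its `≥` HALF ALONE — the `≤` half is kernel (p611233)

Cell `bsd-eis` (home `run/shared/lean/pub/bsd-eis/`), seat `bsd-line-x1-p1` (LEAD, D-0154 row 4). The character-side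
`S`-relaxation input of the line exists in `Literature/…/KellerYin2024/AnomalousImprimitiveLambdaInvariants.lean` in three
strengths (STRONG §3 ⇐ QUOTIENT §5 ⇐ CORANK §6, each implication kernel: p572105, p575256). This file adds the fourth
link: CORANK (`prop125_residualPair_unrSelmer_corank`, §6, an EQUALITY `zpCorank Q p = Σ charLocalLambda`) ⇐ its `≥`
HALF (`prop125_residualPair_unrSelmer_corank_ge`, §7 of the same Literature file: the SAME printed composition —
Pollack–Weston 2011 Prop. A.2 surjectivity of the global-to-local map + the local `λ`-values of KY/CGLS Lemma 1.1.1 —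
read for the one inequality that is NOT a kernel theorem), because the `≤` half is the kernel theorem
`UnrSelmerQuotientCorankLocalLambda.zpCorank_unrSelmer_quotient_le_at_residualPair` (p611233; this D-0154 wave: the
quotient embeds in `∏_{w∈Sf} ∏_{η∣w} H¹(I_η, (F/𝒪)(θ))` whose factors have corank `≤ 𝟙[θ(Frob_w) ≡ Nw]`). So the
skeleton `halves` may register the `≥` half as its character-side [PWL] stub (v15).

* **`prop125_corank_of_ge`** — KERNEL: `prop125_…_corank_ge → prop125_…_corank` (`le_antisymm` with p611233; the
  side conditions `p ∉ w` for `w ∋ N_E` come from `Good W p`, i.e. `p ∤ N_E`, Diamond–Shurman §8.3).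

HONEST FRAMING: theorems between named statements (no definition, no named fact, no `sorry`); nothing booked; 0 stubs
close; BSD / Mazur's MC / IMC2 proved for no curve.
-/

set_option linter.dupNamespace false
set_option autoImplicit false

noncomputable section

open scoped Classical

open WeierstrassCurve NumberField IsDedekindDomain Field
  Literature.NumberTheory.EllipticCurves Literature.NumberTheory.EllipticCurves.ModularForms
  Literature.NumberTheory.QuadraticFields Literature.NumberTheory.EllipticCurves.Rank1Residual
  Literature.NumberTheory.EllipticCurves.Castella2018 Literature.NumberTheory.EllipticCurves.GreenbergSelmer
  Literature.NumberTheory.EllipticCurves.GreenbergVatsal2000 Literature.NumberTheory.GaloisRepresentations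
  Literature.NumberTheory.EllipticCurves.CastellaGrossiLeeSkinner2022
  Literature.NumberTheory.EllipticCurves.KellerYin2024
open Summit.BirchSwinnertonDyer.BirchSwinnertonDyer.Theorems
  Summit.BirchSwinnertonDyer.BirchSwinnertonDyer.Theorems.UnrSelmerQuotientCorankLocalLambda

namespace Summit.BirchSwinnertonDyer.BirchSwinnertonDyer.Theorems.GoodLatticeCorankOfGe

/-- `p ∉ w` for a place `w ∋ N` when `p ∤ N`: else `1 = a p + b N ∈ w`. [folklore] -/
theorem natCast_notMem_of_intCast_mem {K : Type} [Field K] [NumberField K] {p N : ℕ} (hpN : ¬ p ∣ N)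
    (hp : p.Prime) (w : HeightOneSpectrum (𝓞 K)) (hw : ((N : ℤ) : 𝓞 K) ∈ w.asIdeal) :
    ((p : ℕ) : 𝓞 K) ∉ w.asIdeal := by
  intro hpw
  have hcop : IsCoprime (p : ℤ) (N : ℤ) :=
    Nat.isCoprime_iff_coprime.mpr ((Nat.Prime.coprime_iff_not_dvd hp).mpr hpN)
  obtain ⟨a, b, hab⟩ := hcop
  have hw' : ((N : ℕ) : 𝓞 K) ∈ w.asIdeal := by exact_mod_cast hw
  have h1 : (1 : 𝓞 K) ∈ w.asIdeal := by
    have e := congrArg (fun z : ℤ ↦ (z : 𝓞 K)) hab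
    push_cast at e
    rw [← e]
    exact w.asIdeal.add_mem (w.asIdeal.mul_mem_left _ hpw) (w.asIdeal.mul_mem_left _ hw')
  exact w.isPrime.ne_top ((Ideal.eq_top_iff_one _).mpr h1)

/-- **[PWL-θ] CORANK ⇐ [PWL-θ] CORANK-`≥`**: `prop125_residualPair_unrSelmer_corank_ge` implies
`prop125_residualPair_unrSelmer_corank` — the `≤` inequality is the kernel theorem
`UnrSelmerQuotientCorankLocalLambda.zpCorank_unrSelmer_quotient_le_at_residualPair` (p611233) at the crux's data
(`K` imaginary quadratic, `2 < p`, (Heeg) for `N_E`, `κ` anticyclotomic, `θ ∈ {θsub, θquot}` Teichmüller, `Sf` the primes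
over `N_E`, which avoid `p` because `Good W p` means `p ∤ N_E` — `dvd_conductorNorm_iff_not_hasGoodReductionAtPrime`).
[cite: KellerYin2024, Prop. 1.2.5 and proof (arXiv:2402.12781v2 TeX L780–800)] [cite: PollackWeston2011, App. A Prop. A.2]
[cite: DiamondShurman2005, §8.3 (PDF p. 353)] -/
theorem prop125_corank_of_ge (h : prop125_residualPair_unrSelmer_corank_ge) :
    prop125_residualPair_unrSelmer_corank := by
  intro W _ _ p _ hp hgood hred hanom hlat K _ _ hK hH hHp htor ι v vbar hv hvbar hne κ hκ γ _ θsub θquot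
    hpair Sf hSf θ hθ hRH
  have hγ : κ.IsTopGenerator γ := Fact.out
  have hpN : ¬ p ∣ W.conductorNorm ℤ := fun hd ↦
    (W.dvd_conductorNorm_iff_not_hasGoodReductionAtPrime p).mp hd hgood
  have hSp : ∀ w ∈ Sf, ((p : ℕ) : 𝓞 K) ∉ w.asIdeal := fun w hw ↦
    natCast_notMem_of_intCast_mem hpN Fact.out w ((hSf w).mp hw)
  exact le_antisymm
    (zpCorank_unrSelmer_quotient_le_at_residualPair hK hp hH κ hκ hγ vbar θsub θquot hpair Sf hSf hSp θ hθ)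
    (h W p hp hgood hred hanom hlat K hK hH hHp htor ι v vbar hv hvbar hne κ hκ γ θsub θquot hpair Sf hSf θ
      hθ hRH)

end Summit.BirchSwinnertonDyer.BirchSwinnertonDyer.Theorems.GoodLatticeCorankOfGe

end
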